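import Literature.Barriers.CriticalPhenomena.GaussianDominationRouteProofs
import Literature.Barriers.CriticalPhenomena.GaussianDominationRouteBootstrap
import Literature.Barriers.CriticalPhenomena.LaceExpansionIsingDeconvolution
import Literature.Probability.Percolation.InfraredBoundTriangle
import Literature.Probability.Percolation.TwoPointMoments
import Mathlib.Analysis.Normed.Group.FunctionSeries
import Mathlib.Probability.ConditionalProbability
import HarnessLib

/-!
# `FitznerVanDerHofstad2017_nobleBound` one level down: the three NoBLE bootstrap functions of
# Fitzner–van der Hofstad, the continuity of `f₁`, `f₂` (PROVED), and the reduction of the NoBLE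
# bound to Prop. 2.4 (the computer-assisted bootstrap) and Lemma 3.5 of [FitHof13b]

Sibling of `GaussianDominationRouteProofs.lean` (barrier catalogue
`Literature/Barriers/CriticalPhenomena/`). There the named fact
`FitznerVanDerHofstad2017_nobleBound` (`∀ d ≥ 11, NobleBootstrapBound d`:
`τ̂_p(k)[1 - D̂(k)] ≤ ((2d-2)/(2d-1)) γ₂` on `[1/(2d-1), p_c)`, Fitzner–van der Hofstad 2016
[FitHof13b], Thm. 2.10, first bound, for percolation) was isolated as the single open node of the
percolation infrared bound in `d ≥ 11`, and `nobleBootstrapBound_of_bootstrap` proved [FitHof13b]'s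
"proof of Thm. 2.10 subject to Prop. 2.11" for an ABSTRACT finite family of bootstrap functions.
This file instantiates that family with the three bootstrap functions PRINTED by the sources
(Fitzner–van der Hofstad 2017, (2.19)–(2.21) = [FitHof13b] (2.5)–(2.7)) and splits the node along
the three claims of Fitzner–van der Hofstad 2017, §2.4 ("(i) `p ↦ f_i(p)` is continuous for all
`p ∈ [1/(2d-1), p_c)`; (ii) `f_i(1/(2d-1)) ≤ γ_i`; (iii) if `f_i(p) ≤ Γ_i` holds for `i = 1,2,3`,
then in fact `f_i(p) ≤ γ_i` … Together, these three claims imply … the statement of Theorem 1.1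
for all `p ∈ [1/(2d-1), p_c)`"):

* `f₁(p) = max{(2d-1) μ̄_p, c_μ (2d-1) μ_p}` with `μ̄_p = p` and
  `μ_p = p · P_p(e₁ ∉ 𝒞(0) | the bond (0, e₁) is vacant)` (FvdH 2017 (2.19) and §2.4,
  "Continuity of `μ̄_p` and `μ_p`"; [FitHof13b] (1.24), (2.5)) — `nobleMu`, `nobleF1`;
* `f₂(p) = ((2d-1)/(2d-2)) sup_k [1 - D̂(k)] |τ̂_p(k)|` ([FitHof13b] (2.6); FvdH 2017 (2.20)
  prints it without the absolute value, `τ̂_p ≥ 0` for percolation) — `nobleSup2`, `nobleF2`;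
* `f₃(p) = max_{(n,l,S) ∈ 𝒮} sup_{x ∈ S} ℋ^{n,l}_p(x) / c_{n,l,S}`,
  `ℋ^{n,l}_p(x) = Σ_y ‖y‖₂² τ_p(y) (τ_p^{⋆n} ⋆ D^{⋆l})(x - y)` ([FitHof13b] (2.7), (3.9)), over the
  printed index set `𝒮 = {(0,0,𝒳),(1,0,𝒳),(1,1,𝒳),(1,2,𝒳),(1,3,𝒳),(1,6,{0})}`,
  `𝒳 = {x : ‖x‖₂ > 1}` (FvdH 2017 (2.23)) — `srwStep` (`D`), `nobleH` (over the tree's `latticeConv`,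
  `convPow`), `calX`, `nobleSupH`,
  `nobleTriple`, `nobleF3`; the family `nobleF d c_μ c : Fin 3 → [0,1] → ℝ`.

PROVED here: claim (i) for `f₁` (`continuousOn_nobleF1`, via the closed form
`μ_p = p (1 - τ_p(0,e₁))/(1 - p)`, `nobleMu_eq`, and the continuity of `p ↦ τ_p(x,y)`,
`continuous_tau` of `TwoPointMoments.lean`) and for `f₂` (`continuousOn_nobleF2` = [FitHof13b]
Lemma 3.3 for percolation, on `[0, p_c)`: `|τ̂_q(k) - τ̂_p(k)| ≤ χ(q) - χ(p)` for `p ≤ q`,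
`tauHat_sub_abs_le`, so `|sup_k … (q) - sup_k … (p)| ≤ 2(χ(q) - χ(p))`, and `χ` is continuous on
`[0, p_c)` by dominated convergence from the sharpness-based summability
`summable_tau_of_lt_criticalProb`; `continuousOn_chi_Iic` of `TwoPointMoments.lean`); and the ASSEMBLY
`FitznerVanDerHofstad2017_nobleBound_of_prop24`: claims (ii)+(iii) (the named fact
`FitznerVanDerHofstad2017_prop24`, the computer-assisted Prop. 2.4 with its initialisation) and
claim (i) for `f₃` (the named fact `FitznerVanDerHofstad2016NoBLE_lemma35`, [FitHof13b] Lemma 3.5)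
imply `FitznerVanDerHofstad2017_nobleBound`, through `nobleBootstrapBound_of_bootstrap` with
`f_{i₂} = f₂ ≥ ((2d-1)/(2d-2)) [1 - D̂(k)] τ̂_p(k)` (`mul_tauHat_le_nobleSup2`).

Remaining for `FitznerVanDerHofstad2017_nobleBound_holds`: `FitznerVanDerHofstad2016NoBLE_lemma35`
(continuity of the weighted diagrams, provable from sharpness along the printed proof) and
`FitznerVanDerHofstad2017_prop24` (NoBLE derivation Prop. 2.1, diagrammatic bounds Prop. 2.2,
[FitHof13b] §3 and the rigorous numerics of three Mathematica notebooks — a theory of its own).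

## References

* R. Fitzner, R. van der Hofstad, *Mean-field behavior for nearest-neighbor percolation in
  `d > 10`*, Electron. J. Probab. 22 (2017) no. 43 (arXiv:1506.07977v2, extended version):
  (2.15)–(2.16) (`τ^ι_p`, `P^y_p`), Prop. 2.1, Prop. 2.2, §2.4 ((2.19)–(2.23), claims (i)–(iii),
  "Verification of the assumptions": `μ̄_p = p`, `μ_p = p P_p(e₁ ∉ 𝒞(0) | (0,e₁) vacant)`),
  Prop. 2.4, §2.5 (output of the notebooks: "The first 3 dots … are the verifications that
  `f_i(1/(2d-1)) ≤ γ_i` for `i = 1,2,3`. The next three dots show that the improvement has been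
  successful for all `p < p_c(11)`"), §2.6 ("for appropriately chosen `γ_i` and `Γ_i` for all
  `p ∈ (1/(2d-1), p_c)`").
* R. Fitzner, R. van der Hofstad, *Generalized approach to the non-backtracking lace expansion*,
  Probab. Theory Relat. Fields 169 (2017) 1041–1119 (arXiv:1506.07969; [FitHof13b]): (1.1)–(1.3)
  (`D`, convolution), (1.24), Lemma 2.1, (2.5)–(2.7), Assumptions 2.2–2.4, Def. 2.9, Thm. 2.10,
  Prop. 2.11, §2.4, §2.5 ("Since the bounds are monotone in the dimension, the bounds then also
  follow for all dimensions larger"), Lemma 3.3, (3.9), Lemma 3.5.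
* M. Heydenreich, R. van der Hofstad, *Progress in High-Dimensional Percolation and Random Graphs*
  (2017), §10.4 (10.4.1)–(10.4.5).
* G. Grimmett, *Percolation*, 2nd ed. (1999), §8.3 pp. 203–204 (continuity of `τ_p(x,y)` in `p`).
-/

noncomputable section

namespace Literature.Barriers.CriticalPhenomena

open MeasureTheory Filter Topology Literature.Probability.LatticeModels Literature.Probability.Percolation
open SpreadOutIsing (delta0 latticeConv convPow)
open scoped BigOperators ProbabilityTheory

variable {d : ℕ}

/-! ### `f₁`: the parameters `μ̄_p = p`, `μ_p` and their continuity -/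

/-- The first unit vector `e₁ = (1, 0, …, 0) ∈ ℤ^d` (the zero vector for `d = 0`).
[cite: FitznerVanDerHofstad2017, §2.1 (unit vectors e_ι)] -/
def unitSite1 (d : ℕ) : Site d := fun i => if i.val = 0 then 1 else 0

/-- For `d ≥ 1`, `e₁ ≠ 0`. [folklore] -/
theorem unitSite1_ne_zero (hd : 1 ≤ d) : unitSite1 d ≠ 0 := by
  intro h
  have := congrFun h ⟨0, hd⟩
  simp [unitSite1] at this

/-- For `d ≥ 1`, `e₁` is Mathlib's `Pi.single 0 1`. [folklore] -/
theorem unitSite1_eq_single (hd : 1 ≤ d) : unitSite1 d = Pi.single (⟨0, hd⟩ : Fin d) (1 : ℤ) := by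
  funext j
  by_cases hj : j = ⟨0, hd⟩
  · subst hj; simp [unitSite1]
  · have hj' : j.val ≠ 0 := fun h => hj (Fin.ext h)
    simp [unitSite1, hj, hj']

/-- For `d ≥ 1`, `e₁` is a neighbour of the origin in `ℤ^d`. [folklore] -/
theorem zdGraph_adj_zero_unitSite1 (hd : 1 ≤ d) : (zdGraph d).Adj 0 (unitSite1 d) :=
  (zdGraph_adj_iff 0 _).2 ⟨⟨0, hd⟩, Or.inl (by rw [zero_add, unitSite1_eq_single hd])⟩

/-- The event "the bond `(0, e₁)` is vacant". [cite: FitznerVanDerHofstad2017, §2.4 (definition of μ_p: the bond from 0 to e₁ vacant)] -/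
def bondVacant1 (d : ℕ) : Set (BondConfig (Site d)) := {ω | s((0 : Site d), unitSite1 d) ∉ ω}

/-- **The NoBLE parameter `μ_p` of percolation**:
`μ_p = p · P_p(e₁ ∉ 𝒞(0) | the bond (0, e₁) is vacant)` (conditional probability, Mathlib's
`ProbabilityTheory.cond`; the companion parameter is `μ̄_p = p`).
[cite: FitznerVanDerHofstad2017, §2.4 ("we define μ̄_p = p and μ_p = p P_p(e₁ ∉ 𝒞(0) | … vacant)")]
[cite: FitznerVanDerHofstad2016NoBLE, (1.24)] -/
def nobleMu (d : ℕ) (p : unitInterval) : ℝ :=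
  (p : ℝ) * ((bondPercolation (zdGraph d) p)[|bondVacant1 d]).real (openConn (0 : Site d) (unitSite1 d))ᶜ

/-- **Closed form of `μ_p`**: for `d ≥ 1` and `p < 1`,
`μ_p = p (1 - τ_p(0, e₁)) / (1 - p)`, because `{e₁ ∉ 𝒞(0)} ⊆ {(0,e₁) vacant}` (an open bond
`(0,e₁)` connects `0` to `e₁`) and `P_p((0,e₁) vacant) = 1 - p`. [folklore] -/
theorem nobleMu_eq (hd : 1 ≤ d) (p : unitInterval) (hp : (p : ℝ) < 1) :
    nobleMu d p = p * (1 - tau d p 0 (unitSite1 d)) / (1 - p) := by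
  classical
  set μ := bondPercolation (zdGraph d) p with hμ
  set A : Set (BondConfig (Site d)) := (openConn (0 : Site d) (unitSite1 d))ᶜ with hA
  have hB : MeasurableSet (bondVacant1 d) := (measurableSet_mem _).compl
  have hAm : MeasurableSet A := (measurableSet_openConn_holds (0 : Site d) (unitSite1 d)).compl
  -- `A ⊆ B`
  have hAB : bondVacant1 d ∩ A = A := by
    refine Set.inter_eq_right.2 fun ω hω => ?_
    intro he
    apply hω
    have hadj : (openGraph ω).Adj 0 (unitSite1 d) := by
      rw [openGraph, SimpleGraph.fromEdgeSet_adj]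
      exact ⟨he, (unitSite1_ne_zero hd).symm⟩
    exact hadj.reachable
  -- `P_p(B) = 1 - p`
  have hedge : s((0 : Site d), unitSite1 d) ∈ (zdGraph d).edgeSet :=
    (SimpleGraph.mem_edgeSet _).2 (zdGraph_adj_zero_unitSite1 hd)
  have hBreal : μ.real (bondVacant1 d) = 1 - p := by
    have h1 : μ.real {ω | s((0 : Site d), unitSite1 d) ∈ ω} = p := bondPercolation_cylinder _ p hedge
    have h2 := probReal_compl_eq_one_sub (μ := μ) (measurableSet_mem (s((0 : Site d), unitSite1 d)))
    rw [h1] at h2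
    exact h2
  have hAreal : μ.real A = 1 - tau d p 0 (unitSite1 d) := by
    rw [hA, probReal_compl_eq_one_sub (measurableSet_openConn_holds _ _), tau_def]
  have hBpos : 0 < 1 - (p : ℝ) := by linarith
  -- the conditional probability
  have hcond : (μ[|bondVacant1 d]).real A = (1 - tau d p 0 (unitSite1 d)) / (1 - p) := by
    rw [measureReal_def, ProbabilityTheory.cond_apply hB, hAB, ENNReal.toReal_mul, ENNReal.toReal_inv,
      ← measureReal_def, ← measureReal_def, hBreal, hAreal, div_eq_inv_mul]
  rw [nobleMu, ← hμ, ← hA, hcond, mul_div_assoc]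

/-- **Claim (i) for `μ_p`** ("`p ↦ μ_p` is continuous", FvdH 2017 §2.4 = [FitHof13b]
Assumption 2.4 for percolation), on `[0, 1)` (which contains `[0, p_c)`), `d ≥ 1`.
[cite: FitznerVanDerHofstad2017, §2.4 (Continuity of μ̄_p and μ_p)] [cite: FitznerVanDerHofstad2016NoBLE, Assumption 2.4] -/
theorem continuousOn_nobleMu (hd : 1 ≤ d) :
    ContinuousOn (nobleMu d) {p : unitInterval | (p : ℝ) < 1} := by
  have hform : ContinuousOn (fun p : unitInterval => (p : ℝ) * (1 - tau d p 0 (unitSite1 d)) / (1 - p))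
      {p : unitInterval | (p : ℝ) < 1} := by
    refine ContinuousOn.div ?_ ?_ fun p hp => ?_
    · exact (continuous_subtype_val.mul (continuous_const.sub (continuous_tau 0 _))).continuousOn
    · exact (continuous_const.sub continuous_subtype_val).continuousOn
    · have : (p : ℝ) < 1 := hp
      linarith
  exact hform.congr fun p hp => nobleMu_eq hd p hp

/-- **The bootstrap function `f₁`**: `f₁(p) = max{(2d-1) μ̄_p, c_μ (2d-1) μ_p}` with `μ̄_p = p`,
for a constant `c_μ > 1`. [cite: FitznerVanDerHofstad2017, (2.19)] [cite: FitznerVanDerHofstad2016NoBLE, (2.5)] -/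
def nobleF1 (d : ℕ) (cμ : ℝ) (p : unitInterval) : ℝ :=
  max ((2 * d - 1) * (p : ℝ)) (cμ * (2 * d - 1) * nobleMu d p)

/-- **Claim (i) for `f₁`**: `f₁` is continuous on `[0, 1) ⊇ [0, p_c)` (`d ≥ 1`).
[cite: FitznerVanDerHofstad2017, §2.4 (claim (i))] [cite: FitznerVanDerHofstad2016NoBLE, §3.1 ("z ↦ f₁(z) is also continuous")] -/
theorem continuousOn_nobleF1 (hd : 1 ≤ d) (cμ : ℝ) :
    ContinuousOn (nobleF1 d cμ) {p : unitInterval | (p : ℝ) < 1} := by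
  refine ContinuousOn.sup ?_ ?_
  · exact (continuous_const.mul continuous_subtype_val).continuousOn
  · exact (continuousOn_const.mul (continuousOn_nobleMu hd))

/-! ### `f₂`: `sup_k [1 - D̂(k)] |τ̂_p(k)|` and its continuity ([FitHof13b] Lemma 3.3) -/

/-- `sup_{k ∈ [-π,π]^d} [1 - D̂(k)] |τ̂_p(k)|`, the supremum over the Brillouin zone `cube d`
(a real `iSup`; for `p < p_c` the family is bounded by `2χ(p)`, `oneSubDhat_mul_abs_tauHat_le`; the
printed `sup` is over the open cube `(-π,π)^d`, the same number by continuity and evenness).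
[cite: FitznerVanDerHofstad2016NoBLE, (2.6)] -/
def nobleSup2 (d : ℕ) (p : unitInterval) : ℝ :=
  ⨆ k : cube d, (1 - Dhat d k.1) * |tauHat d p k.1|

/-- **The bootstrap function `f₂`**:
`f₂(p) = sup_k |τ̂_p(k)|/B̂_{1/(2d-1)}(k) = ((2d-1)/(2d-2)) sup_k [1 - D̂(k)] |τ̂_p(k)|`
([FitHof13b] (2.6), with `|Ĝ_z(k)|`; FvdH 2017 (2.20) prints `τ̂_p(k)` without the absolute
value). [cite: FitznerVanDerHofstad2016NoBLE, (2.6)] [cite: FitznerVanDerHofstad2017, (2.20)]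
[cite: HeydenreichVanDerHofstad2017, (10.4.2)] -/
def nobleF2 (d : ℕ) (p : unitInterval) : ℝ :=
  (2 * d - 1) / (2 * d - 2) * nobleSup2 d p

/-- `[1 - D̂(k)] |τ̂_p(k)| ≤ 2 χ(p)` when `τ_p(0,·)` is summable (`χ = chi d`). [folklore] -/
theorem oneSubDhat_mul_abs_tauHat_le (p : unitInterval) (hs : Summable fun x => tau d p 0 x)
    (k : Fin d → ℝ) : (1 - Dhat d k) * |tauHat d p k| ≤ 2 * chi d p :=
  mul_le_mul (one_sub_Dhat_le_two k) (abs_tauHat_le p hs k) (abs_nonneg _) zero_le_two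

/-- The family defining `nobleSup2` is bounded above when `τ_p(0,·)` is summable. [folklore] -/
theorem bddAbove_nobleSup2 (p : unitInterval) (hs : Summable fun x => tau d p 0 x) :
    BddAbove (Set.range fun k : cube d => (1 - Dhat d k.1) * |tauHat d p k.1|) :=
  ⟨2 * chi d p, by rintro _ ⟨k, rfl⟩; exact oneSubDhat_mul_abs_tauHat_le p hs k.1⟩

/-- `[1 - D̂(k)] τ̂_p(k) ≤ sup_k [1 - D̂(k)] |τ̂_p(k)|` on the cube (summable case). [folklore] -/
theorem mul_tauHat_le_nobleSup2 (p : unitInterval) (hs : Summable fun x => tau d p 0 x)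
    {k : Fin d → ℝ} (hk : ∀ j, k j ∈ Set.Icc (-Real.pi) Real.pi) :
    (1 - Dhat d k) * tauHat d p k ≤ nobleSup2 d p :=
  calc (1 - Dhat d k) * tauHat d p k ≤ (1 - Dhat d k) * |tauHat d p k| :=
        mul_le_mul_of_nonneg_left (le_abs_self _) (one_sub_Dhat_nonneg k)
    _ ≤ nobleSup2 d p := le_ciSup (bddAbove_nobleSup2 p hs) (⟨k, Set.mem_univ_pi.2 hk⟩ : cube d)

/-- `nobleSup2 d p ≤ 2 χ(p)` (summable case). [folklore] -/
theorem nobleSup2_le (p : unitInterval) (hs : Summable fun x => tau d p 0 x) :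
    nobleSup2 d p ≤ 2 * chi d p :=
  ciSup_le fun k => oneSubDhat_mul_abs_tauHat_le p hs k.1

/-- Below `p_c` a smaller parameter has a summable two-point function too. [folklore] -/
theorem summable_tau_mono {p q : unitInterval} (hpq : p ≤ q) (hs : Summable fun x => tau d q 0 x) :
    Summable fun x => tau d p 0 x :=
  Summable.of_nonneg_of_le (fun x => tau_nonneg p 0 x) (fun x => tau_mono_left hpq 0 x) hs

/-- **`τ̂` is `χ`-Lipschitz in `p`, uniformly in `k`**: for `p ≤ q` with `τ_q(0,·)` summable,
`|τ̂_q(k) - τ̂_p(k)| ≤ χ(q) - χ(p)` (termwise `0 ≤ τ_q - τ_p` and `|cos| ≤ 1`) — the percolation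
substitute for the derivative bound `|d/dz Ĝ_z(k)| ≤ d/dz Ĝ_z(0)` in the proof of [FitHof13b]
Lemma 3.3. [cite: FitznerVanDerHofstad2016NoBLE, Lemma 3.3 (proof)] -/
theorem tauHat_sub_abs_le {p q : unitInterval} (hpq : p ≤ q) (hs : Summable fun x => tau d q 0 x)
    (k : Fin d → ℝ) :
    |tauHat d q k - tauHat d p k| ≤ chi d q - chi d p := by
  rw [chi_def, chi_def]
  have hsp := summable_tau_mono hpq hs
  have hg : Summable fun x => tau d q 0 x - tau d p 0 x := hs.sub hsp
  have hcq : Summable fun x => Real.cos (kdot k x) * tau d q 0 x :=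
    Summable.of_norm_bounded hs fun x => by
      rw [Real.norm_eq_abs, abs_mul, abs_of_nonneg (tau_nonneg q 0 x)]
      exact mul_le_of_le_one_left (tau_nonneg q 0 x) (Real.abs_cos_le_one _)
  have hcp : Summable fun x => Real.cos (kdot k x) * tau d p 0 x :=
    Summable.of_norm_bounded hsp fun x => by
      rw [Real.norm_eq_abs, abs_mul, abs_of_nonneg (tau_nonneg p 0 x)]
      exact mul_le_of_le_one_left (tau_nonneg p 0 x) (Real.abs_cos_le_one _)
  have hdiff : tauHat d q k - tauHat d p k =
      ∑' x, Real.cos (kdot k x) * (tau d q 0 x - tau d p 0 x) := by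
    rw [tauHat, tauHat, ← hcq.tsum_sub hcp]
    exact tsum_congr fun x => by ring
  rw [hdiff, ← hs.tsum_sub hsp, ← Real.norm_eq_abs]
  refine tsum_of_norm_bounded hg.hasSum fun x => ?_
  have h0 : 0 ≤ tau d q 0 x - tau d p 0 x := sub_nonneg.2 (tau_mono_left hpq 0 x)
  rw [Real.norm_eq_abs, abs_mul, abs_of_nonneg h0]
  exact mul_le_of_le_one_left h0 (Real.abs_cos_le_one _)

/-- The `sup` inherits the modulus of continuity: for `p ≤ q` (summable case),
`|sup_k[1-D̂]|τ̂_q| - sup_k[1-D̂]|τ̂_p|| ≤ 2 (χ(q) - χ(p))`. [cite: FitznerVanDerHofstad2016NoBLE, Lemma 3.3 (proof)] -/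
theorem abs_nobleSup2_sub_le {p q : unitInterval} (hpq : p ≤ q) (hs : Summable fun x => tau d q 0 x) :
    |nobleSup2 d q - nobleSup2 d p| ≤ 2 * (chi d q - chi d p) := by
  have hsp := summable_tau_mono hpq hs
  set Δ := chi d q - chi d p with hΔ
  have hpt : ∀ k : Fin d → ℝ,
      abs ((1 - Dhat d k) * |tauHat d q k| - (1 - Dhat d k) * |tauHat d p k|) ≤ 2 * Δ := by
    intro k
    rw [← mul_sub, abs_mul, abs_of_nonneg (one_sub_Dhat_nonneg k)]
    refine mul_le_mul (one_sub_Dhat_le_two k) ?_ (abs_nonneg _) zero_le_two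
    exact (abs_abs_sub_abs_le_abs_sub _ _).trans (tauHat_sub_abs_le hpq hs k)
  rw [abs_le]
  constructor
  · -- `sup_p ≤ sup_q + 2Δ`
    have : nobleSup2 d p ≤ nobleSup2 d q + 2 * Δ := by
      refine ciSup_le fun k => ?_
      have h1 := (abs_le.1 (hpt k.1)).1
      have h2 : (1 - Dhat d k.1) * |tauHat d q k.1| ≤ nobleSup2 d q :=
        le_ciSup (bddAbove_nobleSup2 q hs) k
      linarith
    linarith
  · have : nobleSup2 d q ≤ nobleSup2 d p + 2 * Δ := by
      refine ciSup_le fun k => ?_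
      have h1 := (abs_le.1 (hpt k.1)).2
      have h2 : (1 - Dhat d k.1) * |tauHat d p k.1| ≤ nobleSup2 d p :=
        le_ciSup (bddAbove_nobleSup2 p hsp) k
      linarith
    linarith

/-- **[FitHof13b] Lemma 3.3 for percolation (`d ≥ 2`): `p ↦ sup_k [1 - D̂(k)] |τ̂_p(k)|` is
continuous on `[0, p_c)`** ("The function `z ↦ f₂(z)` defined in (2.6) is continuous for `z` in
`[0, z_c)`"), here from `abs_nobleSup2_sub_le` and the continuity of `χ`.
[cite: FitznerVanDerHofstad2016NoBLE, Lemma 3.3] -/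
theorem continuousOn_nobleSup2 (hd : 2 ≤ d) :
    ContinuousOn (nobleSup2 d) (Set.Iio (criticalProbI d)) := by
  intro p₀ hp₀
  obtain ⟨q, hpq, hqc'⟩ := exists_lt_lt_criticalProbI hp₀
  have hsq := summable_tau_of_lt_criticalProb hd q hqc'
  set χ : unitInterval → ℝ := chi d with hχ
  have hχat : ContinuousAt χ p₀ := (continuousOn_chi_Iic hd hqc').continuousAt (Iic_mem_nhds hpq)
  -- the Lipschitz-type bound, for `p ≤ q`
  have hbound : ∀ p : unitInterval, p ≤ q → |nobleSup2 d p - nobleSup2 d p₀| ≤ 2 * |χ p - χ p₀| := by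
    intro p hp
    rcases le_total p p₀ with h | h
    · have := abs_nobleSup2_sub_le h (summable_tau_mono hpq.le hsq)
      rw [abs_sub_comm, abs_sub_comm (χ p)]
      refine this.trans ?_
      exact mul_le_mul_of_nonneg_left (le_abs_self _) zero_le_two
    · have := abs_nobleSup2_sub_le h (summable_tau_mono hp hsq)
      exact this.trans (mul_le_mul_of_nonneg_left (le_abs_self _) zero_le_two)
  have hat : ContinuousAt (nobleSup2 d) p₀ := by
    rw [ContinuousAt, tendsto_iff_dist_tendsto_zero]
    have hlim : Tendsto (fun p => 2 * |χ p - χ p₀|) (𝓝 p₀) (𝓝 0) := by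
      have h1 : Tendsto (fun p => χ p - χ p₀) (𝓝 p₀) (𝓝 0) := by
        have := hχat.tendsto.sub_const (χ p₀)
        rwa [sub_self] at this
      have h2 := (continuous_abs.tendsto 0).comp h1
      rw [abs_zero] at h2
      have h3 := h2.const_mul 2
      rw [mul_zero] at h3
      exact h3
    refine squeeze_zero' (Eventually.of_forall fun p => dist_nonneg) ?_ hlim
    filter_upwards [Iic_mem_nhds hpq] with p hp
    rw [Real.dist_eq]
    exact hbound p hp
  exact hat.continuousWithinAt

/-- **Claim (i) for `f₂`** (`d ≥ 2`): `f₂` is continuous on `[0, p_c)`.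
[cite: FitznerVanDerHofstad2017, §2.4 (claim (i))] [cite: FitznerVanDerHofstad2016NoBLE, Lemma 3.3] -/
theorem continuousOn_nobleF2 (hd : 2 ≤ d) : ContinuousOn (nobleF2 d) (Set.Iio (criticalProbI d)) :=
  continuousOn_const.mul (continuousOn_nobleSup2 hd)

/-! ### `f₃`: the weighted diagrams `ℋ^{n,l}_p(x)` -/

/-- The nearest-neighbour step distribution `D(x) = 𝟙{‖x‖₁ = 1}/(2d)` on `ℤ^d`.
[cite: FitznerVanDerHofstad2016NoBLE, (1.1)] [cite: FitznerVanDerHofstad2017, §1.3 (D(x) = 𝟙{|x|=1}/(2d))] -/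
def srwStep (d : ℕ) (x : Site d) : ℝ :=
  if (zdGraph d).Adj 0 x then 1 / (2 * d) else 0

/-- **The weighted diagram `ℋ^{n,l}_p(x) = Σ_y ‖y‖₂² τ_p(y) (τ_p^{⋆n} ⋆ D^{⋆l})(x - y)`**, with
the lattice convolution `(f ⋆ g)(x) = Σ_y f(y) g(x - y)` and its powers `f^{⋆0} = δ₀`,
`f^{⋆n} = f^{⋆(n-1)} ⋆ f` of the tree (`SpreadOutIsing.latticeConv`, `SpreadOutIsing.convPow`,
real `tsum`s; here all factors are non-negative and, for `p < p_c`, summable, so these are the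
printed sums). [cite: FitznerVanDerHofstad2016NoBLE, (3.9) and (1.2)–(1.3)]
[cite: FitznerVanDerHofstad2017, (2.21)] -/
def nobleH (d n l : ℕ) (p : unitInterval) (x : Site d) : ℝ :=
  ∑' y : Site d, euclidNorm y ^ 2 * tau d p 0 y *
    latticeConv (convPow (tau d p 0) n) (convPow (srwStep d) l) (x - y)

/-- The point set `𝒳 = {x ∈ ℤ^d : ‖x‖₂ > 1}`. [cite: FitznerVanDerHofstad2017, (2.23)] -/
def calX (d : ℕ) : Set (Site d) := {x | 1 < euclidNorm x}

/-- `sup_{x ∈ S} ℋ^{n,l}_p(x)` (a real `iSup`; `0` for `S = ∅`).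
[cite: FitznerVanDerHofstad2016NoBLE, (2.7) and Lemma 3.5 (proof: "the continuity of z ↦ sup_{x∈S} ℋ_z(x) for all sets S")] -/
def nobleSupH (d n l : ℕ) (S : Set (Site d)) (p : unitInterval) : ℝ :=
  ⨆ x : S, nobleH d n l p x.1

/-- **The index set `𝒮` used for percolation in `d ≥ 11`**:
`𝒮 = {(0,0,𝒳), (1,0,𝒳), (1,1,𝒳), (1,2,𝒳), (1,3,𝒳), (1,6,{0})}` (FvdH 2017 (2.23); the general
paper [FitHof13b], §2.1, prints the last triple as `(1,4,{0})`), enumerated by `Fin 6`.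
[cite: FitznerVanDerHofstad2017, (2.23)] [cite: FitznerVanDerHofstad2016NoBLE, §2.1 (display after (2.7))] -/
def nobleTriple (d : ℕ) : Fin 6 → ℕ × ℕ × Set (Site d) :=
  ![(0, 0, calX d), (1, 0, calX d), (1, 1, calX d), (1, 2, calX d), (1, 3, calX d), (1, 6, {0})]

/-- **The bootstrap function `f₃`**:
`f₃(p) = max_{(n,l,S) ∈ 𝒮} sup_{x ∈ S} ℋ^{n,l}_p(x) / c_{n,l,S}` for positive constants
`c_{n,l,S}` (indexed like `𝒮` by `Fin 6`). [cite: FitznerVanDerHofstad2017, (2.21)]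
[cite: FitznerVanDerHofstad2016NoBLE, (2.7) and (3.10)] -/
def nobleF3 (d : ℕ) (c : Fin 6 → ℝ) (p : unitInterval) : ℝ :=
  Finset.univ.sup' Finset.univ_nonempty fun i : Fin 6 =>
    nobleSupH d (nobleTriple d i).1 (nobleTriple d i).2.1 (nobleTriple d i).2.2 p / c i

/-- The three bootstrap functions `(f₁, f₂, f₃)` of the NoBLE analysis of percolation, as a
family indexed by `Fin 3` (index `0 ↦ f₁`, `1 ↦ f₂`, `2 ↦ f₃`).
[cite: FitznerVanDerHofstad2017, (2.19)–(2.21)] -/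
def nobleF (d : ℕ) (cμ : ℝ) (c : Fin 6 → ℝ) : Fin 3 → unitInterval → ℝ :=
  ![nobleF1 d cμ, nobleF2 d, nobleF3 d c]

/-- Component `0` of the family is `f₁`. [folklore] -/
@[simp] theorem nobleF_zero (cμ : ℝ) (c : Fin 6 → ℝ) : nobleF d cμ c 0 = nobleF1 d cμ := rfl

/-- Component `1` of the family is `f₂`. [folklore] -/
@[simp] theorem nobleF_one (cμ : ℝ) (c : Fin 6 → ℝ) : nobleF d cμ c 1 = nobleF2 d := rfl

/-- Component `2` of the family is `f₃`. [folklore] -/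
@[simp] theorem nobleF_two (cμ : ℝ) (c : Fin 6 → ℝ) : nobleF d cμ c 2 = nobleF3 d c := rfl

/-! ### The two remaining nodes, as named facts -/

/-- NAMED FACT — **[FitHof13b] Lemma 3.5 (continuity of the weighted diagrams), for
percolation**: "The function `z ↦ f₃(z)` as defined in (3.9) is continuous in `z ∈ [z_I, z_c)`",
proved there by showing "the continuity of `z ↦ sup_{x∈S} ℋ^{n,l}_z(x)` for all sets `S`" from
Assumption 2.3 (`Σ_x ‖x‖₂² G_z(x) < K(z)`, `χ(z) < ∞` below `z_c`), which Fitzner–van der Hofstad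
2017, §2.4 verify for percolation from the exponential decay of `τ_p` below `p_c` ([Grim99]).
Vendored as that statement: for `d ≥ 2`, all `n, l` and `S ⊆ ℤ^d`, `p ↦ sup_{x∈S} ℋ^{n,l}_p(x)` is
continuous on `[1/(2d-1), p_c)`. Users take `(h : FitznerVanDerHofstad2016NoBLE_lemma35)`.
[cite: FitznerVanDerHofstad2016NoBLE, Lemma 3.5 (and its proof) and Assumption 2.3]
[cite: FitznerVanDerHofstad2017, §2.4 (claim (i); "[FitHof13b Assumption 2.3]: Growth of the two-point function")] -/
def FitznerVanDerHofstad2016NoBLE_lemma35 : Prop :=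
  ∀ d : ℕ, 2 ≤ d → ∀ (n l : ℕ) (S : Set (Site d)),
    ContinuousOn (nobleSupH d n l S) (Set.Ico (nbwThresholdI d) (criticalProbI d))

/-- NAMED FACT — **Fitzner–van der Hofstad 2017, Prop. 2.4 (successful application of the NoBLE
analysis) with its initialisation — the computer-assisted bootstrap for percolation, `d ≥ 11`**:
"there exist constants `Γ₁,Γ₂,Γ₃` and `γ₁,γ₂,γ₃` such that, for every `p < p_c`, the bounds
`f_i(p) ≤ Γ_i` for `i = 1,2,3` imply that `f_i(p) ≤ γ_i` for `i = 1,2,3`" (Prop. 2.4), where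
`γ_i < Γ_i` (claim (iii)) and, for the same constants, `f_i(1/(2d-1)) ≤ γ_i`, `i = 1,2,3` (claim
(ii); §2.5: "The first 3 dots in the first table are the verifications that `f_i(1/(2d-1)) ≤ γ_i`
for `i = 1,2,3`. The next three dots show that the improvement has been successful for all
`p < p_c(11)`"; [FitHof13b] Prop. 2.11: "`f_i(z_I) < γ_i` … and `f_i(z) ≤ Γ_i` for all `i`
implies that `f_i(z) ≤ γ_i` for all `i`"), for the printed bootstrap functions `f₁, f₂, f₃`
(`nobleF d c_μ c`) with SOME admissible constants `c_μ > 1`, `c_{n,l,S} > 0` ("some well-chosen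
constants", (2.19)–(2.21); their values live in the Mathematica notebooks) — vendored on the
interval `(1/(2d-1), p_c)` on which the bootstrap consumes it (§2.6: "for appropriately chosen `γ_i`
and `Γ_i` for all `p ∈ (1/(2d-1), p_c)`"), and for every `d ≥ 11` ([FitHof13b] §2.5: "Since the
bounds are monotone in the dimension, the bounds then also follow for all dimensions larger").
This is the computer-assisted core of Thm. 1.1 (NoBLE derivation Prop. 2.1, diagrammatic bounds
Prop. 2.2, [FitHof13b] §3, and the rigorous numerics: 112 simple-random-walk integrals after
Hara–Slade and three notebooks); it is NOT formalised. Users take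
`(h : FitznerVanDerHofstad2017_prop24)`.
[cite: FitznerVanDerHofstad2017, Prop. 2.4 with §2.4 (claims (ii)–(iii)) and §2.5–§2.6]
[cite: FitznerVanDerHofstad2016NoBLE, Prop. 2.11 and §2.5] -/
def FitznerVanDerHofstad2017_prop24 : Prop :=
  ∀ d : ℕ, 11 ≤ d → ∃ (cμ : ℝ) (c : Fin 6 → ℝ) (γ Γ : Fin 3 → ℝ),
    1 < cμ ∧ (∀ i, 0 < c i) ∧ (∀ i, γ i < Γ i) ∧
    (∀ i, nobleF d cμ c i (nbwThresholdI d) ≤ γ i) ∧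
    ∀ p : unitInterval, p ∈ Set.Ioo (nbwThresholdI d) (criticalProbI d) →
      (∀ i, nobleF d cμ c i p ≤ Γ i) → ∀ i, nobleF d cμ c i p ≤ γ i

/-! ### Assembly: claims (i)–(iii) give the NoBLE bound -/

/-- `[1/(2d-1), p_c) ⊆ [0, p_c) ⊆ [0, 1)` in `[0, 1]`. [folklore] -/
theorem Ico_nbwThresholdI_subset : Set.Ico (nbwThresholdI d) (criticalProbI d) ⊆ Set.Iio (criticalProbI d) :=
  fun _ hp => hp.2

/-- `[0, p_c) ⊆ {p < 1}`. [folklore] -/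
theorem Iio_criticalProbI_subset : Set.Iio (criticalProbI d) ⊆ {p : unitInterval | (p : ℝ) < 1} := by
  intro p hp
  have h1 : (p : ℝ) < criticalProbI d := Subtype.coe_lt_coe.2 hp
  exact h1.trans_le (criticalProbI d).2.2

/-- Continuity of `f₃` on `[1/(2d-1), p_c)` from that of the weighted diagrams (finite maximum,
positive constants). [cite: FitznerVanDerHofstad2016NoBLE, Lemma 3.5 ("as the index set 𝒮 … is finite")] -/
theorem continuousOn_nobleF3 (h35 : FitznerVanDerHofstad2016NoBLE_lemma35) (hd : 2 ≤ d)
    (c : Fin 6 → ℝ) :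
    ContinuousOn (nobleF3 d c) (Set.Ico (nbwThresholdI d) (criticalProbI d)) := by
  refine ContinuousOn.finset_sup'_apply Finset.univ_nonempty fun i _ => ?_
  exact (h35 d hd _ _ _).div_const (c i)

/-- **Claim (i)**: given [FitHof13b] Lemma 3.5, all three bootstrap functions are continuous on
`[1/(2d-1), p_c)` (`d ≥ 2`). [cite: FitznerVanDerHofstad2017, §2.4 (claim (i))] -/
theorem continuousOn_nobleF (h35 : FitznerVanDerHofstad2016NoBLE_lemma35) (hd : 2 ≤ d) (cμ : ℝ)
    (c : Fin 6 → ℝ) (i : Fin 3) :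
    ContinuousOn (nobleF d cμ c i) (Set.Ico (nbwThresholdI d) (criticalProbI d)) := by
  fin_cases i
  · exact ((continuousOn_nobleF1 (by omega) cμ).mono
      (Ico_nbwThresholdI_subset.trans Iio_criticalProbI_subset))
  · exact (continuousOn_nobleF2 hd).mono Ico_nbwThresholdI_subset
  · exact continuousOn_nobleF3 h35 hd c

/-- `f₂` dominates `((2d-1)/(2d-2)) [1 - D̂(k)] τ̂_p(k)` for `p < p_c`, `k ∈ [-π,π]^d` (`d ≥ 2`) —
the inequality `((2d-1)/(2d-2)) Ĝ_z(k)[1-D̂(k)] ≤ f₂(z)` of [FitHof13b] (2.17).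
[cite: FitznerVanDerHofstad2016NoBLE, §2.4 (2.17)] -/
theorem mul_tauHat_le_nobleF2 (hd : 2 ≤ d) {p : unitInterval} (hp : p < criticalProbI d)
    {k : Fin d → ℝ} (hk : ∀ j, k j ∈ Set.Icc (-Real.pi) Real.pi) :
    (2 * d - 1) / (2 * d - 2) * ((1 - Dhat d k) * tauHat d p k) ≤ nobleF2 d p := by
  have hp' : (p : ℝ) < criticalProb (zdGraph d) (0 : Site d) := by
    rw [← coe_criticalProbI]; exact Subtype.coe_lt_coe.2 hp
  have hs := summable_tau_of_lt_criticalProb hd p hp'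
  have hd' : (2 : ℝ) ≤ d := by exact_mod_cast hd
  refine mul_le_mul_of_nonneg_left (mul_tauHat_le_nobleSup2 p hs hk) ?_
  exact div_nonneg (by linarith) (by linarith)

/-- **The NoBLE bound from claims (i)–(iii)** (Fitzner–van der Hofstad 2017, §2.4: "Together,
these three claims imply that `f_i(p) ≤ γ_i` holds for every `i = 1,2,3` and all
`p ∈ [1/(2d-1), p_c)`. This in turn implies the statement of Theorem 1.1 for all
`p ∈ [1/(2d-1), p_c)`"; [FitHof13b] §2.4, proof of Thm. 2.10 subject to Prop. 2.11): the
computer-assisted Prop. 2.4 (with its initialisation) and [FitHof13b] Lemma 3.5, together with the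
continuity of `f₁`, `f₂` proved above, give `FitznerVanDerHofstad2017_nobleBound`, via
`nobleBootstrapBound_of_bootstrap` with `f_{i₂} = f₂`.
[cite: FitznerVanDerHofstad2017, §2.4 (claims (i)–(iii)) and Prop. 2.4]
[cite: FitznerVanDerHofstad2016NoBLE, §2.4 (proof of Thm. 2.10 subject to Prop. 2.11) and Lemma 2.1] -/
theorem FitznerVanDerHofstad2017_nobleBound_of_prop24 (h35 : FitznerVanDerHofstad2016NoBLE_lemma35)
    (h24 : FitznerVanDerHofstad2017_prop24) : FitznerVanDerHofstad2017_nobleBound := by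
  intro d hd
  obtain ⟨cμ, c, γ, Γ, -, -, hγΓ, h0, himp⟩ := h24 d hd
  refine nobleBootstrapBound_of_bootstrap (by omega) (1 : Fin 3) hγΓ
    (continuousOn_nobleF h35 (by omega) cμ c) h0 himp fun p hp k hk => ?_
  rw [nobleF_one]
  exact mul_tauHat_le_nobleF2 (by omega) hp.2 hk

/-- Hence also the infrared bound itself (`FitznerVanDerHofstad2017_infraredBound`, HvdH Thm. 10.1)
from the same two nodes. [cite: HeydenreichVanDerHofstad2017, Thm. 10.1] [cite: FitznerVanDerHofstad2017, Thm. 1.1 and Prop. 2.4] -/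
theorem FitznerVanDerHofstad2017_infraredBound_of_prop24 (h35 : FitznerVanDerHofstad2016NoBLE_lemma35)
    (h24 : FitznerVanDerHofstad2017_prop24) : FitznerVanDerHofstad2017_infraredBound :=
  FitznerVanDerHofstad2017_infraredBound_of_nobleBound
    (FitznerVanDerHofstad2017_nobleBound_of_prop24 h35 h24)

end Literature.Barriers.CriticalPhenomena

end
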